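import Summits.QuantumFields.GaugeBoot.DiagonalRPTorusTwoTwist
import Summits.QuantumFields.GaugeBoot.DiagonalRPTorusTwoOrbit
import Summits.QuantumFields.GaugeBoot.DiagonalRPTorusTwoBlockHaar
import HarnessLib

/-!
# Diagonal RP on the two-dimensional torus, gauge-invariant sector, II: the half-turn of the back
zigzag is a gauge transformation (gauge-boot, task L3(ε))

HONEST FRAMING (cell `pub-gaugeboot`, page 1 of every file): the venture produces certified bounds
on lattice expectations at stated coupling, gauge group, dimension and torus size; NOT a mass gap,
NOT a continuum limit, NOT a string tension; NOT Yang–Mills-summit-bearing (barriers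
`FixedCouplingUltralocality`, `PerturbativeInvisibility`). This module is part of a small POSITIVE
structural result about which positivity constraints a two-dimensional TORUS certificate may use;
it discharges nothing else.

The links of the closed diagonal half `0 ≤ k ≤ c` (`k = y_i - y_j`, `c = L/2`) that touch the back
layer `k = c` form ONE closed zigzag loop of `2L` links between the layers `c - 1` and `c`:
`A_t → B_t → A_{t+1}` with `A_t = (c-1+t) e_i + t e_j`, `B_t = A_t + e_i` (`zA`, links `(A_t, i)`
and `(B_t, j)`; `exists_eq_of_inHalf_of_tw`). The relabelling `T̂` of
`DiagonalRPTorusTwoTwist.lean` rotates this loop by a half-turn (`t ↦ t + c`, the translation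
`τ`). **A rotation of the link variables of a closed loop is a gauge transformation** (its
holonomy goes to a conjugate): with the partial holonomies `R_t = C_{A_0} ⋯ C_{A_{t-1}}` (`zR`,
`C_y = U(y,i) U(y+e_i,j)`), the field-dependent gauge function
`h(A_t) = R_{t+c}⁻¹ R_t`, `h(B_t) = (R_{t+c} U(A_{t+c},i))⁻¹ R_t U(A_t,i)` (`hA`, `hB`, `hfun`; `1`
off the two layers; well defined on the torus by `L`-periodicity, `hA_add_L`, `hB_add_L`)
satisfies `h(x) U(e) h(x')⁻¹ = U(τ e)` for every zigzag link `e : x → x'` (`gauge_zA`, `gauge_zB`).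
Consequently (`gaugeTransform_untwist_of_inHalf`): on every link of the closed half,
`T̂ U = (untwist U)^{h(U)}`, where `untwist U` (`Ψ₁`) modifies `U` only on the links NOT touching
the back layer that end on the layers `c - 1`, `c` (in the closed half: the links between the
layers `c - 2` and `c - 1`), by the inverse gauge factors — whose values depend on `U` only
through the zigzag links, which `untwist` does not touch. Such a field-dependent two-sided
translation of a block of link variables, with multipliers blind to the block, preserves product
Haar measure (`measurePreserving_blockMul` of `DiagonalRPTorusTwoBlockHaar.lean`;
`measurePreserving_untwist`). This is the measure-theoretic
content of "the twist of the back layer is invisible to gauge-invariant observables", used in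
`DiagonalRPTorusGaugeInvariantTwo.lean`. All statements are proved; the mechanism is the
standard link-by-link change of variables of lattice gauge theory (E. Seiler, LNP 159 (1982),
Ch. 2) and the elementary fact that gauge orbits on a cycle graph are the conjugacy classes of
the holonomy.
-/

open MeasureTheory Complex Finset Function
open scoped ComplexOrder ENNReal

namespace Summit.QuantumFields.GaugeBoot

open Literature.MathematicalPhysics.QuantumFieldTheory

noncomputable section

namespace DiagRPTwo

/-! ## The back zigzag: sites, partial holonomies, the rotation gauge -/

section Zigzag

variable {L : ℕ} {i j : Fin 2}

/-- `A_t = (c - 1 + t) e_i + t e_j`, the `t`-th site of the layer `k = c - 1` (`t` taken mod `L`;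
`j` is the other direction). -/
def zA (i : Fin 2) (t : ℕ) : Site 2 L :=
  fun k => if k = i then cc L - 1 + (t : ZMod L) else (t : ZMod L)

/-- The `i`-coordinate of `A_t`. -/
@[simp] theorem zA_apply_left (t : ℕ) : zA i t i = cc L - 1 + (t : ZMod L) := by simp [zA]

/-- The `j`-coordinate of `A_t`. -/
@[simp] theorem zA_apply_right (hij : i ≠ j) (t : ℕ) : zA i t j = (t : ZMod L) := by
  simp [zA, hij.symm]

/-- `A_t` lies in the layer `c - 1`. -/
theorem kd_zA (hij : i ≠ j) (t : ℕ) : kd i j (zA i t) = cc L - 1 := by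
  rw [kd, zA_apply_left, zA_apply_right hij]; ring

/-- `B_t = A_t + e_i` lies in the back layer `c`. -/
theorem kd_zA_shift (hij : i ≠ j) (t : ℕ) : kd i j ((zA i t).shift i) = cc L := by
  rw [kd_shift_left hij, kd_zA hij]; ring

/-- `A_{t+L} = A_t`. -/
theorem zA_add_L (t : ℕ) : zA i (t + L) = zA (L := L) i t := by
  funext k
  simp only [zA, Nat.cast_add, ZMod.natCast_self, add_zero]

/-- `B_t + e_j = A_{t+1}`. -/
theorem zA_shift_shift (hij : i ≠ j) (t : ℕ) :
    ((zA i t).shift i).shift j = zA (L := L) i (t + 1) := by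
  funext k
  obtain hk | hk := ((by decide : ∀ a b c : Fin 2, a ≠ b → c = a ∨ c = b) i j k hij) <;> rw [hk]
  · have h1 : (Pi.single j (1 : ZMod L) : Fin 2 → ZMod L) i = 0 := Pi.single_eq_of_ne hij _
    simp only [Site.shift, zA, Pi.add_apply, Pi.single_eq_same, h1, ↓reduceIte, Nat.cast_add,
      Nat.cast_one]
    ring
  · have h1 : (Pi.single i (1 : ZMod L) : Fin 2 → ZMod L) j = 0 := Pi.single_eq_of_ne' hij _
    simp only [Site.shift, zA, Pi.add_apply, Pi.single_eq_same, h1, if_neg hij.symm, Nat.cast_add,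
      Nat.cast_one, add_zero]

/-- `τ A_t = A_{t + L/2}`. -/
theorem tauSite_zA (t : ℕ) : tauSite (zA i t) = zA (L := L) i (t + L / 2) := by
  funext k
  by_cases hk : k = i
  · subst hk
    simp only [tauSite, zA, ↓reduceIte, Nat.cast_add, cc]
    ring
  · simp only [tauSite, zA, hk, ↓reduceIte, Nat.cast_add, cc]

variable {G : Type*} [Group G]

variable (i j) in
/-- The partial zigzag holonomy `R_t = C_{A_0} C_{A_1} ⋯ C_{A_{t-1}}`. -/
def zR (X : GaugeConfig 2 L G) : ℕ → G
  | 0 => 1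
  | t + 1 => zR X t * cT i j X (zA i t)

variable (i j) in
/-- The rotation gauge on the layer `c - 1`: `h(A_t) = R_{t+c}⁻¹ R_t`. -/
def hA (X : GaugeConfig 2 L G) (t : ℕ) : G := (zR i j X (t + L / 2))⁻¹ * zR i j X t

variable (i j) in
/-- The rotation gauge on the back layer: `h(B_t) = (R_{t+c} X(A_{t+c}, i))⁻¹ (R_t X(A_t, i))`. -/
def hB (X : GaugeConfig 2 L G) (t : ℕ) : G :=
  (zR i j X (t + L / 2) * X (zA i (t + L / 2), i))⁻¹ * (zR i j X t * X (zA i t, i))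

variable (i j) in
/-- The rotation gauge as a function on sites (`1` off the layers `c - 1` and `c`). -/
def hfun (X : GaugeConfig 2 L G) (y : Site 2 L) : G :=
  if kd i j y = cc L - 1 then hA i j X (y j).val
  else if kd i j y = cc L then hB i j X (y j).val else 1

/-- `R_{t+1} = R_t · X(A_t, i) X(B_t, j)`. -/
theorem zR_succ (X : GaugeConfig 2 L G) (t : ℕ) :
    zR i j X (t + 1) = zR i j X t * (X (zA i t, i) * X ((zA i t).shift i, j)) := rfl

/-- `R_{s+L} = R_L R_s` (the loop closes after `L` transports). -/
theorem zR_add_L (X : GaugeConfig 2 L G) (s : ℕ) : zR i j X (s + L) = zR i j X L * zR i j X s := by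
  induction s with
  | zero => simp [zR]
  | succ s ih =>
    rw [show s + 1 + L = (s + L) + 1 by omega, zR_succ, zR_succ, ih, zA_add_L, mul_assoc]

/-- `h(A_t)` is `L`-periodic. -/
theorem hA_add_L (X : GaugeConfig 2 L G) (t : ℕ) : hA i j X (t + L) = hA i j X t := by
  rw [hA, hA, show t + L + L / 2 = (t + L / 2) + L by omega, zR_add_L, zR_add_L, mul_inv_rev,
    mul_assoc, inv_mul_cancel_left]

/-- `h(B_t)` is `L`-periodic. -/
theorem hB_add_L (X : GaugeConfig 2 L G) (t : ℕ) : hB i j X (t + L) = hB i j X t := by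
  rw [hB, hB, show t + L + L / 2 = (t + L / 2) + L by omega, zR_add_L, zR_add_L, zA_add_L,
    zA_add_L]
  group

/-- Off the layers `c - 1`, `c` the rotation gauge is trivial. -/
theorem hfun_eq_one (X : GaugeConfig 2 L G) {y : Site 2 L} (h1 : kd i j y ≠ cc L - 1)
    (h2 : kd i j y ≠ cc L) : hfun i j X y = 1 := by
  simp only [hfun, if_neg h1, if_neg h2]

/-- `c - 1 ≠ c` in `ZMod L` (`L ≥ 4`). -/
theorem cc_sub_one_ne_cc (h4 : 4 ≤ L) : cc L - 1 ≠ cc L := by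
  intro h
  have h1 : (1 : ZMod L) = 0 := by
    have := congrArg (fun z => cc L - z) h
    simpa using this
  have := val_one_of_four_le h4
  rw [h1, ZMod.val_zero] at this
  omega

/-- `h` at `A_t`. -/
theorem hfun_zA (hij : i ≠ j) (X : GaugeConfig 2 L G) (t : ℕ) :
    hfun i j X (zA i t) = hA i j X t := by
  have hp : Function.Periodic (hA i j X) L := fun s => hA_add_L X s
  rw [hfun, if_pos (kd_zA hij t), zA_apply_right hij, ZMod.val_natCast, hp.map_mod_nat]

/-- `h` at `B_t`. -/
theorem hfun_zB (h4 : 4 ≤ L) (hij : i ≠ j) (X : GaugeConfig 2 L G) (t : ℕ) :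
    hfun i j X ((zA i t).shift i) = hB i j X t := by
  have hp : Function.Periodic (hB i j X) L := fun s => hB_add_L X s
  have hne : kd i j ((zA i t).shift i) ≠ cc L - 1 := by
    rw [kd_zA_shift hij]; exact (cc_sub_one_ne_cc h4).symm
  rw [hfun, if_neg hne, if_pos (kd_zA_shift hij t), WilsonRP.shift_apply_of_ne _ hij.symm,
    zA_apply_right hij, ZMod.val_natCast, hp.map_mod_nat]

/-- **The zigzag link `(A_t, i)` is rotated by the gauge `h`**:
`h(A_t) X(A_t,i) h(B_t)⁻¹ = X(A_{t+c}, i) = X(τ(A_t, i))`. -/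
theorem gauge_zA (h4 : 4 ≤ L) (hij : i ≠ j) (X : GaugeConfig 2 L G) (t : ℕ) :
    hfun i j X (zA i t) * X (zA i t, i) * (hfun i j X ((zA i t).shift i))⁻¹ =
      X (tauEdge (zA i t, i)) := by
  rw [hfun_zA hij, hfun_zB h4 hij, tauEdge, tauSite_zA, hA, hB]
  group

/-- **The zigzag link `(B_t, j)` is rotated by the gauge `h`**:
`h(B_t) X(B_t,j) h(A_{t+1})⁻¹ = X(B_{t+c}, j) = X(τ(B_t, j))`. -/
theorem gauge_zB (h4 : 4 ≤ L) (hij : i ≠ j) (X : GaugeConfig 2 L G) (t : ℕ) :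
    hfun i j X ((zA i t).shift i) * X ((zA i t).shift i, j) *
        (hfun i j X (((zA i t).shift i).shift j))⁻¹ =
      X (tauEdge ((zA i t).shift i, j)) := by
  rw [zA_shift_shift hij, hfun_zA hij, hfun_zB h4 hij, tauEdge]
  simp only [tauSite_shift, tauSite_zA]
  rw [hA, hB, show t + 1 + L / 2 = (t + L / 2) + 1 by omega, zR_succ, zR_succ]
  group

variable [NeZero L]

/-- **The links of the closed half touching the back layer are the zigzag links** `(A_t, i)`,
`(B_t, j)` (`t = y_j`). -/
theorem exists_eq_of_inHalf_of_tw (h4 : 4 ≤ L) (hij : i ≠ j) {e : Edge 2 L} (he : InHalf i j e)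
    (ht : TW i j e) : e = (zA i (e.1 j).val, i) ∨ e = ((zA i (e.1 j).val).shift i, j) := by
  obtain ⟨y, μ⟩ := e
  simp only [InHalf, TW] at he ht
  simp only
  have hcv : (cc L).val = L / 2 := cc_val h4
  have hc1 : (cc L + 1).val = L / 2 + 1 := by
    rw [ZMod.val_add_of_lt, hcv, val_one_of_four_le h4]
    rw [hcv, val_one_of_four_le h4]; omega
  have hyj : ((y j).val : ZMod L) = y j := ZMod.natCast_zmod_val (y j)
  obtain hμ | hμ := ((by decide : ∀ a b c : Fin 2, a ≠ b → c = a ∨ c = b) i j μ hij) <;> subst hμ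
  · -- a link in direction `i`: `k ↦ k + 1`
    left
    have hk : kd μ j y = cc L - 1 := by
      rcases ht with h | h
      · exfalso
        have h2 := he.2
        rw [kd_shift_left hij, h, hc1] at h2
        omega
      · rw [kd_shift_left hij] at h
        rw [← h]; ring
    refine Prod.ext ?_ rfl
    funext k
    dsimp only
    obtain hk' | hk' := ((by decide : ∀ a b c : Fin 2, a ≠ b → c = a ∨ c = b) μ j k hij) <;> rw [hk']
    · rw [zA_apply_left, hyj, ← hk, kd]; ring
    · rw [zA_apply_right hij, hyj]
  · -- a link in direction `j`: `k ↦ k - 1`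
    right
    have hk : kd i μ y = cc L := by
      rcases ht with h | h
      · exact h
      · exfalso
        have h1 := he.1
        rw [kd_shift_right hij] at h
        rw [show kd i μ y = cc L + 1 by rw [← h]; ring, hc1] at h1
        omega
    refine Prod.ext ?_ rfl
    funext k
    dsimp only
    obtain hk' | hk' := ((by decide : ∀ a b c : Fin 2, a ≠ b → c = a ∨ c = b) i μ k hij) <;> rw [hk']
    · rw [WilsonRP.shift_apply_self, zA_apply_left, hyj, ← hk, kd]; ring
    · rw [WilsonRP.shift_apply_of_ne _ hij.symm, zA_apply_right hij, hyj]

end Zigzag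

/-! ## The untwisting map `Ψ₁` -/

section Untwist

variable {L : ℕ} (i j : Fin 2) {G : Type*} [Group G]

/-- `Ψ₁`: conjugate the links NOT touching the back layer by the inverse rotation gauge (this
changes only the links with an endpoint on the layers `c - 1`, `c` that do not touch the back
layer). -/
def untwist (X : GaugeConfig 2 L G) : GaugeConfig 2 L G := fun e =>
  if TW i j e then X e else (hfun i j X e.1)⁻¹ * X e * hfun i j X (e.1.shift e.2)

variable {i j}

/-- `Ψ₁` does not touch the links touching the back layer. -/
theorem untwist_apply_of_tw (X : GaugeConfig 2 L G) {e : Edge 2 L} (he : TW i j e) :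
    untwist i j X e = X e := if_pos he

/-- `Ψ₁` does not touch the links with both endpoints off the layers `c - 1`, `c`. -/
theorem untwist_apply_of_far (X : GaugeConfig 2 L G) {e : Edge 2 L}
    (h1 : kd i j e.1 ≠ cc L - 1) (h2 : kd i j e.1 ≠ cc L)
    (h3 : kd i j (e.1.shift e.2) ≠ cc L - 1) (h4 : kd i j (e.1.shift e.2) ≠ cc L) :
    untwist i j X e = X e := by
  by_cases he : TW i j e
  · exact untwist_apply_of_tw X he
  · simp only [untwist, if_neg he, hfun_eq_one X h1 h2, hfun_eq_one X h3 h4, inv_one, one_mul,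
      mul_one]

/-- Off the back layer, the gauge `h` undoes `Ψ₁`. -/
theorem gaugeTransform_untwist_of_not_tw (X : GaugeConfig 2 L G) {e : Edge 2 L} (he : ¬TW i j e) :
    gaugeTransform (hfun i j X) (untwist i j X) e = X e := by
  simp only [gaugeTransform, untwist, if_neg he]
  group

variable [NeZero L]

/-- **`T̂ X = (Ψ₁ X)^{h(X)}` on the closed half**: the half-turn of the back zigzag is a gauge
transformation, up to the correction `Ψ₁` of the neighbouring links. -/
theorem gaugeTransform_untwist_of_inHalf (h4 : 4 ≤ L) (hij : i ≠ j) (X : GaugeConfig 2 L G)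
    {e : Edge 2 L} (he : InHalf i j e) :
    gaugeTransform (hfun i j X) (untwist i j X) e = configTau i j X e := by
  by_cases ht : TW i j e
  · rw [configTau_apply_of_tw X ht, gaugeTransform, untwist_apply_of_tw X ht]
    rcases exists_eq_of_inHalf_of_tw h4 hij he ht with h | h
    · rw [h]; exact gauge_zA h4 hij X _
    · rw [h]; exact gauge_zB h4 hij X _
  · rw [configTau_apply_of_not_tw X ht, gaugeTransform_untwist_of_not_tw X ht]

end Untwist

/-! ## `Ψ₁` preserves product Haar measure -/

section UntwistMeasure

variable {L : ℕ} [NeZero L] {i j : Fin 2} {G : Type*} [Group G] [TopologicalSpace G]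
  [IsTopologicalGroup G] [CompactSpace G] [MeasurableSpace G] [BorelSpace G]
  [SecondCountableTopology G]

open Classical in
/-- The links touching the back layer, as a finset. -/
def twLinks (i j : Fin 2) : Finset (Edge 2 L) := univ.filter (TW i j)

omit [TopologicalSpace G] [IsTopologicalGroup G] [CompactSpace G] [MeasurableSpace G] [BorelSpace G]
  [SecondCountableTopology G] in
/-- The partial holonomies read only the links touching the back layer. -/
theorem dependsOn_zR (hij : i ≠ j) (t : ℕ) :
    DependsOn (fun X : GaugeConfig 2 L G => zR i j X t) (twLinks (L := L) i j : Set (Edge 2 L)) := by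
  classical
  induction t with
  | zero => intro X Y _; rfl
  | succ t ih =>
    intro X Y hXY
    have h1 : X (zA i t, i) = Y (zA i t, i) :=
      hXY _ (Finset.mem_coe.2 (Finset.mem_filter.2 ⟨Finset.mem_univ _, Or.inr (kd_zA_shift hij t)⟩))
    have h2 : X ((zA i t).shift i, j) = Y ((zA i t).shift i, j) :=
      hXY _ (Finset.mem_coe.2 (Finset.mem_filter.2 ⟨Finset.mem_univ _, Or.inl (kd_zA_shift hij t)⟩))
    have h0 : zR i j X t = zR i j Y t := ih hXY
    show zR i j X (t + 1) = zR i j Y (t + 1)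
    rw [zR_succ, zR_succ, h0, h1, h2]

omit [TopologicalSpace G] [IsTopologicalGroup G] [CompactSpace G] [MeasurableSpace G] [BorelSpace G]
  [SecondCountableTopology G] in
/-- The rotation gauge reads only the links touching the back layer. -/
theorem dependsOn_hfun (hij : i ≠ j) (y : Site 2 L) :
    DependsOn (fun X : GaugeConfig 2 L G => hfun i j X y) (twLinks (L := L) i j : Set (Edge 2 L)) := by
  classical
  intro X Y hXY
  have hR : ∀ t, zR i j X t = zR i j Y t := fun t => dependsOn_zR hij t hXY
  have hX : ∀ t, X (zA i t, i) = Y (zA i t, i) := fun t =>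
    hXY _ (Finset.mem_coe.2 (Finset.mem_filter.2 ⟨Finset.mem_univ _, Or.inr (kd_zA_shift hij t)⟩))
  simp only [hfun, hA, hB, hR, hX]

omit [TopologicalSpace G] [IsTopologicalGroup G] [CompactSpace G] [BorelSpace G]
  [SecondCountableTopology G] in
omit [NeZero L] in
/-- The partial holonomies are measurable. -/
theorem measurable_zR [MeasurableMul₂ G] (t : ℕ) : Measurable fun X : GaugeConfig 2 L G => zR i j X t := by
  induction t with
  | zero => exact measurable_const
  | succ t ih => exact ih.mul (measurable_cT i j _)

omit [TopologicalSpace G] [IsTopologicalGroup G] [CompactSpace G] [BorelSpace G]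
  [SecondCountableTopology G] in
omit [NeZero L] in
/-- The rotation gauge is measurable in the configuration. -/
theorem measurable_hfun [MeasurableMul₂ G] [MeasurableInv G] (y : Site 2 L) :
    Measurable fun X : GaugeConfig 2 L G => hfun i j X y := by
  unfold hfun hA hB
  split_ifs
  · exact (measurable_zR _).inv.mul (measurable_zR _)
  · exact ((measurable_zR _).mul (measurable_pi_apply _)).inv.mul
      ((measurable_zR _).mul (measurable_pi_apply _))
  · exact measurable_const

/-- **`Ψ₁` preserves product Haar measure** (a block skew translation of the links off the back
layer with multipliers read off the back zigzag). -/
theorem measurePreserving_untwist (hij : i ≠ j) :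
    MeasurePreserving (untwist (G := G) (L := L) i j) (linkMeasure L G) (linkMeasure L G) := by
  classical
  have hT : ((twLinks (L := L) i j)ᶜᶜ : Finset (Edge 2 L)) = twLinks i j := compl_compl _
  have h := measurePreserving_blockMul (G := G) ((twLinks (L := L) i j)ᶜ)
    (fun e X => (hfun i j X e.1)⁻¹) (fun e X => hfun i j X (e.1.shift e.2))
    (fun e => (measurable_hfun _).inv) (fun e => measurable_hfun _)
    (fun e => by rw [hT]; intro X Y hXY; exact congrArg (·⁻¹) (dependsOn_hfun hij e.1 hXY))
    (fun e => by rw [hT]; exact dependsOn_hfun hij _)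
  convert h using 2 with X
  funext e
  by_cases he : TW i j e
  · have : e ∉ (twLinks (L := L) i j)ᶜ := by simp [twLinks, he]
    rw [untwist_apply_of_tw X he, if_neg this]
  · have : e ∈ (twLinks (L := L) i j)ᶜ := by simp [twLinks, he]
    simp only [untwist, if_neg he, if_pos this]

end UntwistMeasure

end DiagRPTwo

end

end Summit.QuantumFields.GaugeBoot
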